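import Literature.MathematicalPhysics.QuantumFieldTheory.BalabanImbrieJaffe1984to88.BIJ88RegularityJ286
import Literature.MathematicalPhysics.QuantumFieldTheory.BalabanImbrieJaffe1984to88.BIJ88Smooth43AxialRegular

/-!
# `BalabanImbrieJaffe1984to88.BIJ88Regularity286EndToEnd` — T. Bałaban, J. Imbrie, A. Jaffe, *Effective action and cluster properties of the
abelian Higgs model*, Commun. Math. Phys. **114** (1988) 257–315 [BalabanImbrieJaffe1988], Sect. 5.6 p. 286 [PDF 30]: the verification
paragraph of the regularity of the new background field, verbatim: *"We need to check the regularity condition on ũ_{k+1}. … We verify the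
bound by first checking it for u_k, then noticing that all the operations changing u_k into ũ_{k+1} did not destroy the bound. We use the new
bounds on u(p) in Λ̄^{(k)**}_1 to estimate u_k = (Q^{s*}_ku) exp[−ie_kη𝒟_{k,loc}∂*Q^{e*}_kf^{(k)}] (5.6.3) with constants uniform in k. … In □′
we can write u = exp[ie_k(∂λ + B)] with |B(b)| ≦ cp(e_k)r(e_k). We have f^{(k)} = ∂B in the cube, and so u_k = (Q^{s*}_ke^{ie_k∂λ}) exp
ie_kη[(Q^{s*}_k − 𝒟_{k,loc}∂*Q^{e*}_kG′_kQ^e_k∂)B] (5.6.4). … Note that Q^{s*}_ke^{ie_k∂λ} is a gauge transformation …, so we can delete it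
from u_k. Our desired bound now follows because by (5.4.4), (Q^{s*}_k − 𝒟_{k,loc}∂*Q^{e*}_k∂)□′B = (H_{k,loc} + ∂C_k + w₁)□′B. (5.6.5) The
kernels H_{k,loc}, w₁ and their derivatives are bounded, so A^λ, ∂A^λ, ∂*A^λ are finally all bounded by cp(e_k)r(e_k). … Thus removing
θ_kH_{k,loc}A^{(k)} does not spoil the regularity, and ũ_{k+1} satisfies the regularity condition."* — **COMPOSED END TO END ON THE TORUS
CARRIER OF RECORD** (kind «model instance»): ONE theorem whose hypotheses are printed data on their own rows and whose conclusion is r16's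
`Regular286 cube G e_k η c″ p(e_k) r(e_k) (uTilde561 …)` — no «`Regular286` of `u′_k`» and no «`Regular286` of `u_k`» hypothesis is left
(row C2.Claim@286, owner r16, flip condition of ROWS-C2-part2 v2.45/v2.46).

statement-level skeleton of published theorems with citation tags; proofs where landed; nothing here is a claim about the Yang–Mills mass gap

THE CHAIN (every link a tree theorem; this file only composes).
1. *"first checking it for u"* — p36 g6 `BIJ88Smooth43Axial`: on a non-wrapping box `□′ = [lo, hi]` of the unit lattice carrying
   `|arg u(p)| ≦ e_k·c_f·p(e_k)` ((5.2.2) restricted to plaquettes) the corner-rooted axial gauge writes `u = exp[ie_k(∂λ′ + B)]` on the box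
   bonds (`cfg_eq_exp_grad_add_axialB`, here `eq_expU1_of_mem_boxBonds`) with `|B| ≦ (π/2)(d−1)·n·c_fp(e_k)` (`abs_axialB_le`) and `∂B =
   f^{(k)}` on the box plaquettes (`curl_axialB_eq`, under the printed smallness `(2π(d−1)n + 1)e_kc_fp(e_k) < 2π`).
2. (5.6.3)–(5.6.4) and *"so we can delete it from u_k"* — this seat's g6 `BIJ88Eq564Torus.regular286_of_deleted` (`u_k` is a gauge transform of
   `exp ie_kη[Q^{s*}_kB − g]` on the η-bonds under `□′`, `ηL^k = 1`).
3. (5.6.5) TYPED (`eq565_typed`): from the typed (5.4.1) = (2.20) `Q^{s*}_k − T_k∂ = H_k + ∂^ηC_k` (`h541`, the operator hypothesis of gen 8's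
   `eq5514_torus`) and the DEFINITION (5.4.3)–(5.4.4) of `w₁ = (T_k − 𝒟_{k,loc}∂*Q^{e*}_k)∂□ + H_k□ − H_{k,loc}` (`hW1`): on `□B = B`,
   `Q^{s*}_kB − 𝒟_{k,loc}∂*Q^{e*}_k∂B = H_{k,loc}B + ∂^η(C_kB) + w₁B`.  NEW relative to g6: the `∂^ηC_k□′B` term is a GAUGE TRANSFORMATION and is
   DELETED as well (r16's `regular286_of_eqOn_gaugeU`), as the print's `A^λ` intends — g6's `regular286_backgroundU_of_kernel` asked row sums of
   the whole kernel `H_{k,loc} + ∂C_k + w₁`; here only those of `H_{k,loc}` and `w₁` enter (*"The kernels H_{k,loc}, w₁ and their derivatives are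
   bounded"*), through gen 9's `kernelField_bounds` in the `→ₗ[ℝ]` currency (`linearMap_fieldBounds`).
   ⟹ **`regular286_backgroundU_of_plaquettes`**: `Regular286 cube G e_k η c₁ p(e_k) r(e_k) (u_k)` for the background field (4.2)/(5.6.3)
   `u_k = backgroundU e_k η (Q^{s*}_ku) (𝒟_{k,loc}∂*Q^{e*}_kf^{(k)})` of ANY unit-lattice `U(1)` field `u`, with the explicit constant
   `c₁ = (K₀ + W₀ + K₁ + W₁ + K₂ + W₂)·(π/2)(d−1)N·c_f` (`n ≦ N·r(e_k)`).
4. *"all the operations changing u_k into ũ_{k+1}"* — gen 8's `BIJ88Eq5514Torus.eq5514_torus` ((5.3.3) → (5.4.5)–(5.4.6) → (5.5.13) → (5.5.14) on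
   the torus: on the cube bonds the (5.5.14) field `u′_k` IS a gauge transform (`bgGaugeU`) of `u_k` evaluated at the translated unit-lattice
   field (5.3.1) `u = u′·(Λ-cut-off Q^{s*}v)`), r16's `regular286_of_eqOn_gaugeU` once more, and gen 9's
   `BIJ88RemovedFieldBounds286.regular286_uTilde561_of_kernels` (removal of `θ_kH_{k,loc}A^{(k)} + w₁A′`, constant `c′`).
   ⟹ **`regular286_uTilde561_endToEnd`**: `Regular286 cube G e_k η (c₁ + c′) p(e_k) r(e_k) (uTilde561 e_k η L (Q^{s*}_{k+1}v) θ_k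
   (H_{k,loc}A^{(k)}) (𝒟^η_{k+1,loc}∂*Q^{e*}_{k+1}f))`.

THE HYPOTHESES OF THE END-TO-END THEOREM, each a printed datum on its own row (or geometry of the regions), NONE a regularity statement:
(5.2.2)|_{plaquettes} on the boxes `□′` of the cubes (`hf`, row C2.Eq5.2.1-5.2.6) with the smallness `hsmall` (p. 273 *"e ≪ 1"*, discharged for
`e_k → 0⁺` by p36's `eventually_smallness`); (5.3.1) `u = u′·cutoff(Q^{s*}v)` (`h531`) with `u′ = e^{ie_kA′}` in the axial gauge of the
`L`-blocks, `A′ = A^{(k)} − L^{−2}V` (`hu'`, p. 280; the `hu` of `eq5514_torus`); (5.3.2) on `Λ̄₂^{(k)**}` (`h532`, row C2.Eq5.3.1-5.3.7: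
`f^{(k)} = ∂A′ + L^{−2}Q^{e*}f`); the typed (2.20)/(5.4.1) `h541`, (5.5.11) `h5511`, the definition (5.4.3)–(5.4.4) of `w₁` (`hW1`); the RANGE
statements *"𝒟_{k,loc} has range ½r(e_{k−1})"* (`hdep`: `(𝒟_{k,loc}∂*Q^{e*}_kF)(b)` on a cube bond sees `F` only on the plaquettes of the cube's
box) and *"Λ₄^{(k)*} acts as the identity"* at the cube bonds (`hΛ₄`, the hypothesis of `eq5514_torus`, discharged from range relations in
gen 8's §3 there); the bounds `|A^{(k)}| ≦ c_Ap(e_k)` ((5.9.4), row proved) and `|A′| ≦ c_{A′}p(e_k)` (p. 280); the kernel ROW SUMS of `H_{k,loc}`,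
`∂^ηH_{k,loc}`, `∂^{η*}H_{k,loc}` (`K₀, K₁, K₂`; (2.7)/(2.21), rows C2 §2) and of `w₁`, `∂^ηw₁`, `∂^{η*}w₁` (`W₀, W₁, W₂`; (5.4.7), row C2.Eq5.4.7)
— matrix elements `T(δ_{b′})(b)` of the `→ₗ[ℝ]` operators; `|θ_k| ≦ 1` with Lipschitz constant `ℓ` (*"derivatives of θ_k are bounded"*; for
r16's witness `BIJ88Theta561Witness.theta` this is gen 9's `lip_theta`, `ℓ = 1/N`); GEOMETRY: each cube of the family sits with one unit of
slack in its box `□′ ⊂ Λ̄₂^{(k)}` (`hin`, `hG`, `hboxB`, `hboxP`: box bonds/plaquettes inside `Λ̄₂^{(k)*}`/`Λ̄₂^{(k)**} = (starB/starP Xb)`),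
and lies in `B^{k+1}(Λ)`, `B^k(X₀)`, `Λ̄₃` (`hc₁`, `hc₀`, `hc₃`: the standing ranges of `eq5514_torus`); numerics `e_k > 0`, `c_f, c_A, c_{A′},
p(e_k) ≧ 0`, `r(e_k) ≧ 1`, `K₁, W₁ ≧ 0` (automatic once a plaquette exists).
HONEST SCOPE.  (i) The print bounds `|B| ≦ cp(e_k)r(e_k)` with the generic `c`; here the constants are explicit and not optimised (`c₁ + c′`).
(ii) The bridging hypotheses ARE the two range statements `hdep`/`hΛ₄`, the decomposition (5.3.2) `h532` and the axial small-field form `hu'` of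
`u′` — printed sentences of rows C2.Eq5.3.1-5.3.7 / C2.Eq5.5.1-5.5.12, taken as displayed hypotheses exactly as gen 8's `eq5514_torus` takes them;
they are not regularity statements.  (iii) The `j`-th condition (e_j, ζ) is gen 9's `BIJ88RegularityJ286` applied to the output of step 3 and
is not restated.  (iv) `K₀, …, W₂` are GLOBAL row-sum bounds (all η-bonds), as in gen 9; the print needs them on the cubes only.
Imports: this seat's `BIJ88RegularityJ286` (closure: gen 6/8/9 files, r16's `BIJ88Regularity286`, r18's carriers) + p36's
`BIJ88Smooth43AxialRegular`.  Unit `lit-balaban-p31` (literature-prover-lit-balaban-p31-g9-0), 2026-08-21.  NOT summit progress.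
-/

namespace Literature.MathematicalPhysics.QuantumFieldTheory.BalabanImbrieJaffe1984to88.BIJ88Regularity286EndToEnd

open Literature.MathematicalPhysics.QuantumFieldTheory.Balaban1983to89
open BIJ88Sect3Statements (U1 toC cfg plaqVar starB mem_starB starP gaugeU)
open BIJ88Sect4Statements (Smooth43 backgroundU bgGaugeU bgGaugeU_eq)
open BIJ88Regularity286 (Regular286 cubeSites regular286_of_eqOn regular286_of_eqOn_gaugeU)
open BIJ88Sect5StatementsPart3 (bgExp uTilde561)
open BIJ88Smooth43Phase (regular286_exp)
open BIJ88Smooth43Axial (lamOf axialB cfg_eq_exp_grad_add_axialB abs_axialB_le curl_axialB_eq)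
open BIJ88Smooth43AxialRegular (starB_subset_boxBonds)
open BIJ88Ineq217NearPart (boxCut_of_not_mem)
open BIJ88Eq564Torus (regular286_of_deleted starB_mono)
open BIJ88Eq5514Torus (eq5514_torus)
open BIJ88RemovedFieldBounds286 (kernelField_bounds regular286_uTilde561_of_kernels diverg_add nonneg_of_rowSum_le)
open BIJ85BlockAveragesTorus (expU1 surfMul toC_expU1)
open BIJ85Eq453GaugeField (qsstarGIter)
open BIJ85Eq224Proof (torusBlockBondsIter)
open BIJ88Eq536Linearization (cutoff)
open BIJ88Eq533Torus (blockUnion)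
open BIJ88Sect3Rescaling (toC_injective_U1)
open T4AxialGaugeSmallField (boxBonds boxPlaqs castSite axialGauge)
open LatticeFieldCalculus (grad curl diverg supDist curl_add)
open Complex
open scoped Real

noncomputable section

variable {P : Params} {i n : ℕ}

/-! ## §0  Plumbing: the axial form as `expU1`, kernel bounds in the `→ₗ[ℝ]` currency, sums of bounded fields -/

/-- **«In □′ we can write u = exp[ie_k(∂λ + B)]»** in the `GaugeField`/`expU1` typing consumed by `BIJ88Eq564Torus` (hypothesis `hu` there): on a
box bond, `u(b) = expU1(e_k((∂λ′)(b) + B(b)))` with p36's `λ′ = lamOf(axialGauge)/e_k`, `B = axialB` (`cfg_eq_exp_grad_add_axialB` through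
`toC`). [cite: BalabanImbrieJaffe1988, (4.3) p.286] -/
theorem eq_expU1_of_mem_boxBonds {ek : ℝ} (hek : ek ≠ 0) (U : GaugeField P n U1) {lo hi : Fin P.d → ℤ} {b : PBond P n}
    (hb : b ∈ boxBonds lo hi) :
    U b = expU1 (ek * (grad 1 (fun x => lamOf (axialGauge U lo hi) x / ek) b + axialB ek U lo hi b)) := by
  apply toC_injective_U1
  rw [toC_expU1, mul_comm _ I]
  exact cfg_eq_exp_grad_add_axialB hek U hb

/-- The same on all bonds of `X*` when every site of `X` sits with one unit of slack in the box (p36's `starB_subset_boxBonds`).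
[cite: BalabanImbrieJaffe1988, (4.3) p.286] -/
theorem eq_expU1_on_starB {ek : ℝ} (hek : ek ≠ 0) (U : GaugeField P n U1) {lo hi : Fin P.d → ℤ}
    {X : Finset (Balaban1983to89.Site P n)}
    (hin : ∀ x ∈ X, ∃ z : Fin P.d → ℤ, lo ≤ z ∧ (∀ κ, z κ + 1 ≤ hi κ) ∧ (castSite z : Balaban1983to89.Site P n) = x) :
    ∀ c ∈ starB X, U c = expU1 (ek * (grad 1 (fun x => lamOf (axialGauge U lo hi) x / ek) c + axialB ek U lo hi c)) :=
  fun _ hc => eq_expU1_of_mem_boxBonds hek U (starB_subset_boxBonds hin _ hc)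

/-- kernel: **a linear operator between the finite function spaces IS a kernel field**, `TA = (b ↦ Σ_{b′} T(δ_{b′})(b)·A(b′))` — the
function-level form, for ANY `DecidableEq` instance on the index type (the torus bonds `PBond` carry r16's instance, so gen 9's pointwise
classical `linearMap_apply_eq_kernel_sum` does not rewrite here). [cite: BalabanImbrieJaffe1988, (4.3) p.286] -/
theorem linearMap_eq_kernelField {α β : Type*} [Fintype β] [DecidableEq β] (T : (β → ℝ) →ₗ[ℝ] (α → ℝ)) (A : β → ℝ) :
    (T A : α → ℝ) = fun b => ∑ b', T (fun j => if b' = j then (1 : ℝ) else 0) b * A b' := by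
  funext b
  have hA : A = ∑ b', A b' • (fun j => if b' = j then (1 : ℝ) else 0) := pi_eq_sum_univ A
  calc T A b = T (∑ b', A b' • fun j => if b' = j then (1 : ℝ) else 0) b := by rw [← hA]
    _ = (∑ b', T (A b' • fun j => if b' = j then (1 : ℝ) else 0)) b := by rw [map_sum]
    _ = ∑ b', T (A b' • fun j => if b' = j then (1 : ℝ) else 0) b := Finset.sum_apply _ _ _
    _ = ∑ b', T (fun j => if b' = j then (1 : ℝ) else 0) b * A b' :=
        Finset.sum_congr rfl fun b' _ => by rw [map_smul, Pi.smul_apply, smul_eq_mul, mul_comm]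

/-- **«The kernels … and their derivatives are bounded, so …»** in the `→ₗ[ℝ]` currency of `BIJ88Eq5514Torus`: if the matrix elements
`T(δ_{b′})(b)` of a linear operator `T` have row sums `≦ K₀`, those of `∂^cT(δ_{b′})` row sums `≦ K₁` and those of `∂^{c*}T(δ_{b′})` `≦ K₂`, and
`|A| ≦ M`, then `|TA| ≦ K₀M`, `|∂^c(TA)| ≦ K₁M`, `|∂^{c*}(TA)| ≦ K₂M` (gen 9's `kernelField_bounds` after `linearMap_eq_kernelField`).
[cite: BalabanImbrieJaffe1988, (4.3) p.286] -/
theorem linearMap_fieldBounds {β : Type*} [Fintype β] [DecidableEq β] {c M K₀ K₁ K₂ : ℝ} (T : (β → ℝ) →ₗ[ℝ] (PBond P n → ℝ))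
    {A : β → ℝ} (hM : 0 ≤ M) (hA : ∀ b', |A b'| ≤ M) (hK₀ : ∀ b, ∑ b', |T (fun j => if b' = j then (1 : ℝ) else 0) b| ≤ K₀)
    (hK₁ : ∀ p, ∑ b', |curl c (fun b => T (fun j => if b' = j then (1 : ℝ) else 0) b) p| ≤ K₁)
    (hK₂ : ∀ x, ∑ b', |diverg c (fun b => T (fun j => if b' = j then (1 : ℝ) else 0) b) x| ≤ K₂) :
    (∀ b, |T A b| ≤ K₀ * M) ∧ (∀ p, |curl c (T A) p| ≤ K₁ * M) ∧ ∀ x, |diverg c (T A) x| ≤ K₂ * M := by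
  rw [linearMap_eq_kernelField T A]
  exact kernelField_bounds hM hA hK₀ hK₁ hK₂

/-- kernel: the sum of two fields bounded together with their `∂^c`, `∂^{c*}` is bounded by the sums of the bounds.
[cite: BalabanImbrieJaffe1988, (4.3) p.286] -/
theorem fieldBounds_add {c G₀ G₁ G₂ V₀ V₁ V₂ : ℝ} {F₁ F₂ : PBond P n → ℝ} (h₀ : ∀ b, |F₁ b| ≤ G₀) (h₁ : ∀ p, |curl c F₁ p| ≤ G₁)
    (h₂ : ∀ x, |diverg c F₁ x| ≤ G₂) (h₀' : ∀ b, |F₂ b| ≤ V₀) (h₁' : ∀ p, |curl c F₂ p| ≤ V₁)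
    (h₂' : ∀ x, |diverg c F₂ x| ≤ V₂) :
    (∀ b, |F₁ b + F₂ b| ≤ G₀ + V₀) ∧ (∀ p, |curl c (fun b => F₁ b + F₂ b) p| ≤ G₁ + V₁) ∧
      ∀ x, |diverg c (fun b => F₁ b + F₂ b) x| ≤ G₂ + V₂ := by
  refine ⟨fun b => (abs_add_le _ _).trans (add_le_add (h₀ b) (h₀' b)), fun p => ?_, fun x => ?_⟩
  · rw [curl_add]
    exact (abs_add_le _ _).trans (add_le_add (h₁ p) (h₁' p))
  · rw [diverg_add]
    exact (abs_add_le _ _).trans (add_le_add (h₂ x) (h₂' x))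

/-! ## §1  (5.6.5) typed: `Q^{s*}_kB − 𝒟_{k,loc}∂*Q^{e*}_k∂B = H_{k,loc}B + ∂^η(C_kB) + w₁B` on `□B = B` -/

/-- **(5.6.5)** p. 286, verbatim: *"by (5.4.4), (Q^{s*}_k − 𝒟_{k,loc}∂*Q^{e*}_k∂)□′B = (H_{k,loc} + ∂C_k + w₁)□′B. (5.6.5)"* — TYPED over the torus
operators of `BIJ88Eq5514Torus`: from (5.4.1) = (2.20) `Q^{s*}_kB − T_k∂B = H_kB + ∂^ηC_kB` (`h541`, `T_k = 𝒟_k∂*Q^{e*}_k`) and the definition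
(5.4.3)–(5.4.4) `w₁ = (T_k − 𝒟_{k,loc}∂*Q^{e*}_k)∂□ + H_k□ − H_{k,loc}` (`hW1`; `𝒟_{k,loc}∂*Q^{e*}_k = Dloc ∘ S`), for a field with `□B = B`:
`(Q^{s*}_kB)(b) − (𝒟_{k,loc}∂*Q^{e*}_k∂B)(b) = (H_{k,loc}B)(b) + (∂^ηC_kB)(b) + (w₁B)(b)` (r16's ring-level `BIJ88Sect5StatementsPart3.eq565` is the
same algebra in one operator ring). [cite: BalabanImbrieJaffe1988, (5.6.5) p.286] -/
theorem eq565_typed {k : ℕ} {η : ℝ} (Tk : (Balaban1983to89.Plaq P (i + k) → ℝ) →ₗ[ℝ] (PBond P i → ℝ))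
    (Dloc : (PBond P i → ℝ) →ₗ[ℝ] (PBond P i → ℝ)) (S : (Balaban1983to89.Plaq P (i + k) → ℝ) →ₗ[ℝ] (PBond P i → ℝ))
    (Hk Hloc : (PBond P (i + k) → ℝ) →ₗ[ℝ] (PBond P i → ℝ)) (Ck : (PBond P (i + k) → ℝ) →ₗ[ℝ] (Balaban1983to89.Site P i → ℝ))
    (h541 : ∀ (B : PBond P (i + k) → ℝ) (b : PBond P i),
      (torusBlockBondsIter P i k).Qsstar B b - Tk (curl 1 B) b = Hk B b + grad η⁻¹ (Ck B) b)
    (box : Set (PBond P (i + k))) (W1 : (PBond P (i + k) → ℝ) →ₗ[ℝ] (PBond P i → ℝ))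
    (hW1 : ∀ (B : PBond P (i + k) → ℝ) (b : PBond P i),
      W1 B b = Tk (curl 1 (box.indicator B)) b - Dloc (S (curl 1 (box.indicator B))) b + (Hk (box.indicator B) b - Hloc B b))
    {B : PBond P (i + k) → ℝ} (hB : box.indicator B = B) (b : PBond P i) :
    (torusBlockBondsIter P i k).Qsstar B b - Dloc (S (curl 1 B)) b = Hloc B b + grad η⁻¹ (Ck B) b + W1 B b := by
  have h1 := h541 B b
  have h2 := hW1 B b
  rw [hB] at h2
  linarith

/-! ## §2  «first checking it for u» ⟹ (5.6.3)–(5.6.5) ⟹ the regularity of `u_k`, from the plaquette restriction and the kernel row sums -/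

/-- **THE REGULARITY OF `u_k` FROM (5.2.2)|_{plaquettes} AND THE KERNELS** (p. 286, *"We verify the bound by first checking it for u_k … Thus we can
assume that |f^{(k)}(p)| ≦ cp(e_k) … Fix □ ⊂ Λ^{(k)}_1 … In □′ … we can write u = exp[ie_k(∂λ + B)] with |B(b)| ≦ cp(e_k)r(e_k). We have f^{(k)} = ∂B
in the cube, and so (5.6.4) … so we can delete it from u_k. Our desired bound now follows because by (5.4.4), (5.6.5). The kernels H_{k,loc}, w₁
and their derivatives are bounded, so A^λ, ∂A^λ, ∂*A^λ are finally all bounded by cp(e_k)r(e_k)"*).  SETTING: `u` any unit-lattice `U(1)` field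
(level `i + k` of the torus; the η-lattice is level `i`, `ηL^k = 1`); the background field (4.2) = (5.6.3) `u_k = backgroundU e_k η (Q^{s*}_ku) g`
with `g = 𝒟_{k,loc}∂*Q^{e*}_kf^{(k)} = Dloc (S f^{(k)})`, `f^{(k)}(p) = arg u(p)/e_k` the real field strength; a family of cubes (r16's `cube`,
labels `Gs`), each inside the η-blocks under a unit-lattice site set `X′` whose points sit with one unit of slack in a non-wrapping box `□′ =
[lo, hi]` of `n + 1 ≦ N·r(e_k) + 1` sites per direction, the box bonds lying in `□ = box` (the region of the `□` of `w₁`).  DATA AS PRINTED: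
`|arg u(p)| ≦ e_k·c_f·p(e_k)` on the box plaquettes and `(2π(d−1)n + 1)e_kc_fp(e_k) < 2π`; the typed (2.20)/(5.4.1) `h541`; the definition of
`w₁` (`hW1`); the range statement `hdep` (*"𝒟_{k,loc} has range ½r(e_{k−1})"*: at a cube bond `Dloc (S F)` sees `F` on the box plaquettes only);
row sums `K₀, K₁, K₂` of `H_{k,loc}`, `∂^ηH_{k,loc}`, `∂^{η*}H_{k,loc}` and `W₀, W₁, W₂` of `w₁`, `∂^ηw₁`, `∂^{η*}w₁`.  CONCLUSION: `Regular286 cube Gs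
e_k η c₁ p(e_k) r(e_k) u_k`, `c₁ = (K₀ + W₀ + K₁ + W₁ + K₂ + W₂)·(π/2)(d−1)N·c_f` — the gauge function deletes BOTH `Q^{s*}_ke^{ie_k∂λ}` and
`e^{ie_kη∂^η(C_k□′B)}`. [cite: BalabanImbrieJaffe1988, (5.6.5) p.286] -/
theorem regular286_backgroundU_of_plaquettes {k : ℕ} (hk : i + k ≤ P.m + P.K) {ek η : ℝ} (hek : 0 < ek)
    (hη : η * (P.L : ℝ) ^ k = 1) (u : GaugeField P (i + k) U1) {γ : Type*} (cube : Balaban1983to89.Site P i → γ) (Gs : Set γ)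
    (lo hi : γ → Fin P.d → ℤ) (X' : γ → Finset (Balaban1983to89.Site P (i + k))) {nb N : ℕ}
    {cf pek rek K₀ K₁ K₂ W₀ W₁ W₂ : ℝ} (hcf : 0 ≤ cf) (hp : 0 ≤ pek)
    (hn : ∀ l ∈ Gs, ∀ κ, hi l κ ≤ lo l κ + nb) (hnN : nb < P.sitesPerDir (i + k)) (hnr : (nb : ℝ) ≤ N * rek)
    (hin : ∀ l ∈ Gs, ∀ x ∈ X' l,
      ∃ z : Fin P.d → ℤ, lo l ≤ z ∧ (∀ κ, z κ + 1 ≤ hi l κ) ∧ (castSite z : Balaban1983to89.Site P (i + k)) = x)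
    (hG : ∀ l ∈ Gs, cubeSites cube l ⊆ blockUnion k (X' l))
    (hf : ∀ l ∈ Gs, ∀ p ∈ boxPlaqs (lo l) (hi l), |arg (plaqVar (cfg u) p)| ≤ ek * (cf * pek))
    (hsmall : (2 * π * ((P.d - 1 : ℕ) : ℝ) * nb + 1) * (ek * (cf * pek)) < 2 * π)
    (Tk : (Balaban1983to89.Plaq P (i + k) → ℝ) →ₗ[ℝ] (PBond P i → ℝ)) (Dloc : (PBond P i → ℝ) →ₗ[ℝ] (PBond P i → ℝ))
    (S : (Balaban1983to89.Plaq P (i + k) → ℝ) →ₗ[ℝ] (PBond P i → ℝ)) (Hk Hloc : (PBond P (i + k) → ℝ) →ₗ[ℝ] (PBond P i → ℝ))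
    (Ck : (PBond P (i + k) → ℝ) →ₗ[ℝ] (Balaban1983to89.Site P i → ℝ))
    (h541 : ∀ (B : PBond P (i + k) → ℝ) (b : PBond P i),
      (torusBlockBondsIter P i k).Qsstar B b - Tk (curl 1 B) b = Hk B b + grad η⁻¹ (Ck B) b)
    (box : Set (PBond P (i + k))) (W1 : (PBond P (i + k) → ℝ) →ₗ[ℝ] (PBond P i → ℝ))
    (hW1 : ∀ (B : PBond P (i + k) → ℝ) (b : PBond P i),
      W1 B b = Tk (curl 1 (box.indicator B)) b - Dloc (S (curl 1 (box.indicator B))) b + (Hk (box.indicator B) b - Hloc B b))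
    (hbox : ∀ l ∈ Gs, boxBonds (lo l) (hi l) ⊆ box)
    (hdep : ∀ l ∈ Gs, ∀ b ∈ starB (cubeSites cube l), ∀ F₁ F₂ : Balaban1983to89.Plaq P (i + k) → ℝ,
      (∀ p ∈ boxPlaqs (lo l) (hi l), F₁ p = F₂ p) → Dloc (S F₁) b = Dloc (S F₂) b)
    (hK₀ : ∀ b, ∑ b', |Hloc (fun j => if b' = j then (1 : ℝ) else 0) b| ≤ K₀)
    (hK₁ : ∀ p, ∑ b', |curl η⁻¹ (fun b => Hloc (fun j => if b' = j then (1 : ℝ) else 0) b) p| ≤ K₁)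
    (hK₂ : ∀ x, ∑ b', |diverg η⁻¹ (fun b => Hloc (fun j => if b' = j then (1 : ℝ) else 0) b) x| ≤ K₂)
    (hW₀ : ∀ b, ∑ b', |W1 (fun j => if b' = j then (1 : ℝ) else 0) b| ≤ W₀)
    (hW₁ : ∀ p, ∑ b', |curl η⁻¹ (fun b => W1 (fun j => if b' = j then (1 : ℝ) else 0) b) p| ≤ W₁)
    (hW₂ : ∀ x, ∑ b', |diverg η⁻¹ (fun b => W1 (fun j => if b' = j then (1 : ℝ) else 0) b) x| ≤ W₂)
    (hK₁' : 0 ≤ K₁) (hW₁' : 0 ≤ W₁) :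
    Regular286 cube Gs ek η ((K₀ + W₀ + K₁ + W₁ + K₂ + W₂) * (π / 2 * ((P.d - 1 : ℕ) : ℝ) * N * cf)) pek rek
      (backgroundU ek η (cfg (qsstarGIter k u)) (Dloc (S fun p => arg (plaqVar (cfg u) p) / ek))) := by
  have hη0 : η ≠ 0 := by
    rintro rfl
    rw [zero_mul] at hη
    exact zero_ne_one hη
  have ha : 0 ≤ cf * pek := mul_nonneg hcf hp
  have hM0 : 0 ≤ π / 2 * (((P.d - 1 : ℕ) : ℝ) * nb * (cf * pek)) := by positivity
  -- the row-sum bounds the torus makes visible are nonnegative (a bond and a site always exist)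
  have hK₀' : 0 ≤ K₀ := nonneg_of_rowSum_le (hK₀ ⟨default, ⟨0, P.hd⟩⟩)
  have hK₂' : 0 ≤ K₂ := nonneg_of_rowSum_le (hK₂ default)
  have hW₀' : 0 ≤ W₀ := nonneg_of_rowSum_le (hW₀ ⟨default, ⟨0, P.hd⟩⟩)
  have hW₂' : 0 ≤ W₂ := nonneg_of_rowSum_le (hW₂ default)
  have hS0 : 0 ≤ K₀ + W₀ + K₁ + W₁ + K₂ + W₂ := by linarith
  have hQ0 : 0 ≤ π / 2 * ((P.d - 1 : ℕ) : ℝ) * cf * pek := by positivity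
  -- `(K_j + W_j)·M ≦ c₁·p·r` for `M = (π/2)(d−1)·n·c_fp`, `n ≦ N·r`
  have hcM : ∀ X : ℝ, 0 ≤ X → X ≤ K₀ + W₀ + K₁ + W₁ + K₂ + W₂ →
      X * (π / 2 * (((P.d - 1 : ℕ) : ℝ) * nb * (cf * pek))) ≤
        (K₀ + W₀ + K₁ + W₁ + K₂ + W₂) * (π / 2 * ((P.d - 1 : ℕ) : ℝ) * N * cf) * pek * rek := by
    intro X hX0 hXS
    calc X * (π / 2 * (((P.d - 1 : ℕ) : ℝ) * nb * (cf * pek)))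
        ≤ (K₀ + W₀ + K₁ + W₁ + K₂ + W₂) * (π / 2 * (((P.d - 1 : ℕ) : ℝ) * nb * (cf * pek))) :=
          mul_le_mul_of_nonneg_right hXS hM0
      _ = (K₀ + W₀ + K₁ + W₁ + K₂ + W₂) * (π / 2 * ((P.d - 1 : ℕ) : ℝ) * cf * pek) * nb := by ring
      _ ≤ (K₀ + W₀ + K₁ + W₁ + K₂ + W₂) * (π / 2 * ((P.d - 1 : ℕ) : ℝ) * cf * pek) * (N * rek) :=
          mul_le_mul_of_nonneg_left hnr (mul_nonneg hS0 hQ0)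
      _ = (K₀ + W₀ + K₁ + W₁ + K₂ + W₂) * (π / 2 * ((P.d - 1 : ℕ) : ℝ) * N * cf) * pek * rek := by ring
  intro l hl
  -- cube `l`: its box, the axial form of `u` on `X′*`, the axial potential `B = axialB`, `|B| ≦ M`, `f^{(k)} = ∂B` on the box
  have hu := eq_expU1_on_starB hek.ne' u (hin l hl)
  have hBM : ∀ b', |axialB ek u (lo l) (hi l) b'| ≤ π / 2 * (((P.d - 1 : ℕ) : ℝ) * nb * (cf * pek)) :=
    abs_axialB_le hek ha u (hf l hl) (hn l hl) hnN
  have hFB : ∀ p ∈ boxPlaqs (lo l) (hi l),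
      (fun p => arg (plaqVar (cfg u) p) / ek) p = curl 1 (axialB ek u (lo l) (hi l)) p :=
    fun p hpl => (curl_axialB_eq hek ha u (hf l hl) (hn l hl) hnN hsmall hpl).symm
  -- `□B = B`: `B` vanishes off the box bonds, which lie in `□`
  have hBbox : box.indicator (axialB ek u (lo l) (hi l)) = axialB ek u (lo l) (hi l) := by
    funext c
    by_cases hc : c ∈ boxBonds (lo l) (hi l)
    · exact Set.indicator_of_mem (hbox l hl hc) _
    · have h0 : axialB ek u (lo l) (hi l) c = 0 := by
        unfold axialB
        exact boxCut_of_not_mem _ hc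
      rw [h0]
      exact Set.indicator_apply_eq_zero.2 fun _ => h0
  -- the three bounds on `G = H_{k,loc}B + w₁B`
  obtain ⟨a0, a1, a2⟩ := linearMap_fieldBounds (c := η⁻¹) Hloc hM0 hBM hK₀ hK₁ hK₂
  obtain ⟨b0, b1, b2⟩ := linearMap_fieldBounds (c := η⁻¹) W1 hM0 hBM hW₀ hW₁ hW₂
  obtain ⟨c0, c1, c2⟩ := fieldBounds_add a0 a1 a2 b0 b1 b2
  -- `Regular286` on the singleton family `{l}`: delete `Q^{s*}_ke^{ie_k∂λ}` (g6) and `e^{ie_kη∂^η(C_kB)}` (here), bound the rest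
  have h1 : Regular286 cube ({l} : Set γ) ek η ((K₀ + W₀ + K₁ + W₁ + K₂ + W₂) * (π / 2 * ((P.d - 1 : ℕ) : ℝ) * N * cf)) pek rek
      (backgroundU ek η (cfg (qsstarGIter k u)) (Dloc (S fun p => arg (plaqVar (cfg u) p) / ek))) := by
    refine regular286_of_deleted hk hη (X' l) hu _ cube (fun l' hl' => ?_) ?_
    · rw [Set.mem_singleton_iff.1 hl']
      exact hG l hl
    refine regular286_of_eqOn_gaugeU (fun x => -(ek * Ck (axialB ek u (lo l) (hi l)) x))
      (uk := fun b => exp (I * ((ek * η * (Hloc (axialB ek u (lo l) (hi l)) b + W1 (axialB ek u (lo l) (hi l)) b) : ℝ) : ℂ)))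
      (fun l' hl' b hb => ?_) ?_
    · -- the identity at a cube bond: (5.6.4)'s `g = T_loc∂B`, (5.6.5), and the gradient as a gauge transformation
      rw [Set.mem_singleton_iff.1 hl'] at hb
      have hg : Dloc (S fun p => arg (plaqVar (cfg u) p) / ek) b = Dloc (S (curl 1 (axialB ek u (lo l) (hi l)))) b :=
        hdep l hl b hb _ _ hFB
      have h565 := eq565_typed Tk Dloc S Hk Hloc Ck h541 box W1 hW1 hBbox b
      simp only [bgExp, gaugeU, one_mul]
      rw [hg, h565, ← Complex.exp_add, ← Complex.exp_add]
      congr 1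
      have hre : ek * η * (Hloc (axialB ek u (lo l) (hi l)) b + grad η⁻¹ (Ck (axialB ek u (lo l) (hi l))) b +
            W1 (axialB ek u (lo l) (hi l)) b) =
          -(ek * Ck (axialB ek u (lo l) (hi l)) b.src) +
              ek * η * (Hloc (axialB ek u (lo l) (hi l)) b + W1 (axialB ek u (lo l) (hi l)) b) +
            ek * Ck (axialB ek u (lo l) (hi l)) b.tgt := by
        simp only [grad, smul_eq_mul]
        field_simp
        ring
      rw [hre]
      push_cast
      ring
    · exact regular286_exp
        (fun _ _ b _ => (c0 b).trans (by rw [← add_mul]; exact hcM _ (add_nonneg hK₀' hW₀') (by linarith)))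
        (fun _ _ p _ => (c1 p).trans (by rw [← add_mul]; exact hcM _ (add_nonneg hK₁' hW₁') (by linarith)))
        (fun _ _ x _ => (c2 x).trans (by rw [← add_mul]; exact hcM _ (add_nonneg hK₂' hW₂') (by linarith)))
  exact h1 l rfl

/-! ## §3  The paragraph end to end: `Regular286 … (uTilde561 …)` from printed data only -/

/-- **C2.Claim@286 END TO END ON THE TORUS OF RECORD** (p. 286: *"We need to check the regularity condition on ũ_{k+1}. … We verify the bound by
first checking it for u_k, then noticing that all the operations changing u_k into ũ_{k+1} did not destroy the bound. … Thus removing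
θ_kH_{k,loc}A^{(k)} does not spoil the regularity, and ũ_{k+1} satisfies the regularity condition."*).  SETTING = gen 8's `eq5514_torus`: the data
`u′, v, Λ = X, A = A^{(k)}, V, L`, the operators `T_k, 𝒟_{k,loc} = Dloc, 𝒟^η_{k+1,loc} = Dnext, ∂*Q^{e*}_k = S, H_k, H_{k,loc}, C_k, C^{(k)}_{loc},
H*_{k,loc}, Q^{e*} = Qes, f`, the regions `Λ̄₂ = Xb ⊇ X₀`, `Λ̄₃ = S₃`, and `w₁` as the operator `W1` (`hW1`, (5.4.3)–(5.4.4) with `□ = Λ̄₂^{(k)*}`);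
the translated unit-lattice field (5.3.1) `u = u′·cutoff_Λ(Q^{s*}v)` (`h531`) whose background field is `u_k = backgroundU e_k η (Q^{s*}_ku)
(𝒟_{k,loc}∂*Q^{e*}_kf^{(k)})`, `f^{(k)}(p) = arg u(p)/e_k`.  HYPOTHESES (printed data on their own rows, see the module docstring): (5.2.2) on the
plaquettes of the cube boxes + smallness; `u′ = e^{ie_kA′}` on `B¹(Λ)*`, `A′ = A − L^{−2}V` (`hu'`); (5.3.2) on `Λ̄₂^{(k)**}` (`h532`); `h541`,
`h5511`, `hW1`; the range statements `hdep`, `hΛ₄`; `|A| ≦ c_Ap`, `|A′| ≦ c_{A′}p`; row sums `K₀, K₁, K₂` (`H_{k,loc}`) and `W₀, W₁, W₂` (`w₁`);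
`|θ_k| ≦ 1`, Lipschitz `ℓ`; geometry of cubes and boxes.  CONCLUSION: **`Regular286 cube Gs e_k η (c₁ + c′) p(e_k) r(e_k) (uTilde561 e_k η L
(Q^{s*}_{k+1}v) θ_k (H_{k,loc}A^{(k)}) (𝒟^η_{k+1,loc}∂*Q^{e*}_{k+1}f))`**, `c₁ = (K₀ + W₀ + K₁ + W₁ + K₂ + W₂)(π/2)(d−1)Nc_f`, `c′ = (K₀(1 + (2 +
d)|η⁻¹|ℓ) + K₁ + K₂)c_A + (W₀ + W₁ + W₂)c_{A′}` — NO regularity hypothesis on `u_k` or `u′_k`. [cite: BalabanImbrieJaffe1988, (4.3) p.286] -/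
theorem regular286_uTilde561_endToEnd {k : ℕ} (hk : i + k + 1 ≤ P.m + P.K) {ek η : ℝ} (hek : 0 < ek) (hη : η * (P.L : ℝ) ^ k = 1)
    -- the fields of (5.3.1) and the translated unit-lattice field `u`
    (X : Finset (Balaban1983to89.Site P (i + k + 1))) {u' : GaugeField P (i + k) U1} (A V : PBond P (i + k) → ℝ) (L : ℝ)
    (hu' : ∀ c ∈ starB (blockUnion 1 X), u' c = expU1 (ek * (A - L⁻¹ ^ 2 • V) c)) (v : GaugeField P (i + k + 1) U1)
    {u : GaugeField P (i + k) U1} (h531 : u = surfMul u' (cutoff (starB X) v))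
    -- the operators of `eq5514_torus` and `w₁`
    {Plc : Type*} (Tk : (Balaban1983to89.Plaq P (i + k) → ℝ) →ₗ[ℝ] (PBond P i → ℝ))
    (Dloc Dnext : (PBond P i → ℝ) →ₗ[ℝ] (PBond P i → ℝ)) (S : (Balaban1983to89.Plaq P (i + k) → ℝ) →ₗ[ℝ] (PBond P i → ℝ))
    (Hk Hloc : (PBond P (i + k) → ℝ) →ₗ[ℝ] (PBond P i → ℝ)) (Ck : (PBond P (i + k) → ℝ) →ₗ[ℝ] (Balaban1983to89.Site P i → ℝ))
    (Cloc : (PBond P (i + k) → ℝ) →ₗ[ℝ] (PBond P (i + k) → ℝ)) (Hsloc : (PBond P i → ℝ) →ₗ[ℝ] (PBond P (i + k) → ℝ))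
    (h541 : ∀ (B : PBond P (i + k) → ℝ) (b : PBond P i),
      (torusBlockBondsIter P i k).Qsstar B b - Tk (curl 1 B) b = Hk B b + grad η⁻¹ (Ck B) b)
    (h5511 : Dloc + Hloc ∘ₗ Cloc ∘ₗ Hsloc = Dnext)
    (Qes : (Plc → ℝ) →ₗ[ℝ] (Balaban1983to89.Plaq P (i + k) → ℝ)) (f : Plc → ℝ)
    (Xb X₀ : Finset (Balaban1983to89.Site P (i + k))) (hX₀ : X₀ ⊆ Xb) (S₃ : Finset (Balaban1983to89.Site P i))
    (W1 : (PBond P (i + k) → ℝ) →ₗ[ℝ] (PBond P i → ℝ))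
    (hW1 : ∀ (B : PBond P (i + k) → ℝ) (b : PBond P i),
      W1 B b = Tk (curl 1 ((↑(starB Xb) : Set (PBond P (i + k))).indicator B)) b -
          Dloc (S (curl 1 ((↑(starB Xb) : Set (PBond P (i + k))).indicator B))) b +
        (Hk ((↑(starB Xb) : Set (PBond P (i + k))).indicator B) b - Hloc B b))
    -- the cubes, their boxes, the geometry
    {γ : Type*} (cube : Balaban1983to89.Site P i → γ) (Gs : Set γ) (lo hi : γ → Fin P.d → ℤ)
    (X' : γ → Finset (Balaban1983to89.Site P (i + k))) {nb N : ℕ}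
    {cf pek rek ℓ cA cA' K₀ K₁ K₂ W₀ W₁ W₂ : ℝ} (hcf : 0 ≤ cf) (hp : 0 ≤ pek) (hr : 1 ≤ rek) (hcA : 0 ≤ cA) (hcA' : 0 ≤ cA')
    (hn : ∀ l ∈ Gs, ∀ κ, hi l κ ≤ lo l κ + nb) (hnN : nb < P.sitesPerDir (i + k)) (hnr : (nb : ℝ) ≤ N * rek)
    (hin : ∀ l ∈ Gs, ∀ x ∈ X' l,
      ∃ z : Fin P.d → ℤ, lo l ≤ z ∧ (∀ κ, z κ + 1 ≤ hi l κ) ∧ (castSite z : Balaban1983to89.Site P (i + k)) = x)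
    (hG : ∀ l ∈ Gs, cubeSites cube l ⊆ blockUnion k (X' l))
    (hboxB : ∀ l ∈ Gs, ∀ c ∈ boxBonds (lo l) (hi l), c ∈ starB Xb)
    (hboxP : ∀ l ∈ Gs, ∀ p ∈ boxPlaqs (lo l) (hi l), p ∈ starP Xb)
    (hc₁ : ∀ l ∈ Gs, cubeSites cube l ⊆ blockUnion (k + 1) X) (hc₀ : ∀ l ∈ Gs, cubeSites cube l ⊆ blockUnion k X₀)
    (hc₃ : ∀ l ∈ Gs, cubeSites cube l ⊆ S₃)
    -- (5.2.2) on the plaquettes of the boxes, and the smallness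
    (hf : ∀ l ∈ Gs, ∀ p ∈ boxPlaqs (lo l) (hi l), |arg (plaqVar (cfg u) p)| ≤ ek * (cf * pek))
    (hsmall : (2 * π * ((P.d - 1 : ℕ) : ℝ) * nb + 1) * (ek * (cf * pek)) < 2 * π)
    -- (5.3.2) on `Λ̄₂^{(k)**}`; the range statements
    (h532 : ∀ p ∈ starP Xb, arg (plaqVar (cfg u) p) / ek = curl 1 (A - L⁻¹ ^ 2 • V) p + L⁻¹ ^ 2 * Qes f p)
    (hdep : ∀ l ∈ Gs, ∀ b ∈ starB (cubeSites cube l), ∀ F₁ F₂ : Balaban1983to89.Plaq P (i + k) → ℝ,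
      (∀ p ∈ boxPlaqs (lo l) (hi l), F₁ p = F₂ p) → Dloc (S F₁) b = Dloc (S F₂) b)
    (hΛ₄ : ∀ l ∈ Gs, ∀ b ∈ starB (cubeSites cube l), Hloc V b = Hloc (Cloc (Hsloc (S (Qes f)))) b)
    -- the printed bounds: (5.9.4), p. 280, the kernel row sums of `H_{k,loc}` and `w₁`, `θ_k`
    (hA : ∀ b', |A b'| ≤ cA * pek) (hA' : ∀ b', |(A - L⁻¹ ^ 2 • V) b'| ≤ cA' * pek)
    (hK₀ : ∀ b, ∑ b', |Hloc (fun j => if b' = j then (1 : ℝ) else 0) b| ≤ K₀)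
    (hK₁ : ∀ p, ∑ b', |curl η⁻¹ (fun b => Hloc (fun j => if b' = j then (1 : ℝ) else 0) b) p| ≤ K₁)
    (hK₂ : ∀ x, ∑ b', |diverg η⁻¹ (fun b => Hloc (fun j => if b' = j then (1 : ℝ) else 0) b) x| ≤ K₂)
    (hW₀ : ∀ b, ∑ b', |W1 (fun j => if b' = j then (1 : ℝ) else 0) b| ≤ W₀)
    (hW₁ : ∀ p, ∑ b', |curl η⁻¹ (fun b => W1 (fun j => if b' = j then (1 : ℝ) else 0) b) p| ≤ W₁)
    (hW₂ : ∀ x, ∑ b', |diverg η⁻¹ (fun b => W1 (fun j => if b' = j then (1 : ℝ) else 0) b) x| ≤ W₂)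
    (hK₁' : 0 ≤ K₁) (hW₁' : 0 ≤ W₁)
    {θ : PBond P i → ℝ} (hθ : ∀ b, |θ b| ≤ 1)
    (hLip : ∀ b b' : PBond P i, |θ b - θ b'| ≤ ℓ * (supDist b.src b'.src : ℝ)) (hℓ : 0 ≤ ℓ) :
    Regular286 cube Gs ek η
      ((K₀ + W₀ + K₁ + W₁ + K₂ + W₂) * (π / 2 * ((P.d - 1 : ℕ) : ℝ) * N * cf) +
        ((K₀ * (1 + (2 + P.d) * |η⁻¹| * ℓ) + K₁ + K₂) * cA + (W₀ + W₁ + W₂) * cA')) pek rek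
      (uTilde561 ek η L (fun b => toC (qsstarGIter (k + 1) v b)) θ (Hloc A) (Dnext (S (Qes f)))) := by
  have hk' : i + k ≤ P.m + P.K := Nat.le_of_succ_le hk
  have hη0 : η ≠ 0 := by
    rintro rfl
    rw [zero_mul] at hη
    exact zero_ne_one hη
  -- STEP 1 (§2): the regularity of `u_k` itself, from the plaquette restriction and the kernels
  have hUk : Regular286 cube Gs ek η ((K₀ + W₀ + K₁ + W₁ + K₂ + W₂) * (π / 2 * ((P.d - 1 : ℕ) : ℝ) * N * cf)) pek rek
      (backgroundU ek η (fun b => toC (qsstarGIter k u b)) (Dloc (S fun p => arg (plaqVar (cfg u) p) / ek))) :=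
    regular286_backgroundU_of_plaquettes hk' hek hη u cube Gs lo hi X' hcf hp hn hnN hnr hin hG hf hsmall Tk Dloc S Hk Hloc Ck
      h541 _ W1 hW1 (fun l hl c hc => Finset.mem_coe.2 (hboxB l hl c hc)) hdep hK₀ hK₁ hK₂ hW₀ hW₁ hW₂ hK₁' hW₁'
  -- STEP 2: on the cube bonds the (5.5.14) field `u′_k` is a gauge transform of `u_k` (`eq5514_torus`)
  have hU' : Regular286 cube Gs ek η ((K₀ + W₀ + K₁ + W₁ + K₂ + W₂) * (π / 2 * ((P.d - 1 : ℕ) : ℝ) * N * cf)) pek rek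
      (bgExp ek η (fun b => toC (qsstarGIter (k + 1) v b))
        fun b => Hloc A b - L⁻¹ ^ 2 * Dnext (S (Qes f)) b + W1 (A - L⁻¹ ^ 2 • V) b) := by
    refine regular286_of_eqOn_gaugeU
      (fun x => ek * (↑S₃ : Set (Balaban1983to89.Site P i)).indicator
        (Ck ((↑(starB Xb) : Set (PBond P (i + k))).indicator (A - L⁻¹ ^ 2 • V))) x)
      (fun l hl b hb => ?_) hUk
    have hT : Dloc (S fun p => arg (plaqVar (cfg u) p) / ek) b = Dloc (S (curl 1 (A - L⁻¹ ^ 2 • V) + L⁻¹ ^ 2 • Qes f)) b :=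
      hdep l hl b hb _ _ fun p hpl => by
        simp only [Pi.add_apply, Pi.smul_apply, smul_eq_mul]
        exact h532 p (hboxP l hl p hpl)
    have e := eq5514_torus hk hη X A V L hu' v (Dloc (S fun p => arg (plaqVar (cfg u) p) / ek)) Tk Dloc Dnext S Hk Hloc Ck Cloc
      Hsloc h541 h5511 Qes f Xb X₀ hX₀ S₃ (starB_mono (hc₁ l hl) hb) (starB_mono (hc₀ l hl) hb) (starB_mono (hc₃ l hl) hb) hT
      (fun F₁ F₂ hF => hdep l hl b hb F₁ F₂ fun p hpl => hF p (hboxP l hl p hpl)) (hΛ₄ l hl b hb)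
    rw [bgGaugeU_eq hη0, ← h531] at e
    simp only [bgExp] at e ⊢
    rw [hW1]
    exact e.symm
  -- STEP 3: the kernel form of the (5.5.14) exponent, then gen 9's removal of `θ_kH_{k,loc}A^{(k)} + w₁A′`
  have h' : Regular286 cube Gs ek η ((K₀ + W₀ + K₁ + W₁ + K₂ + W₂) * (π / 2 * ((P.d - 1 : ℕ) : ℝ) * N * cf)) pek rek
      (bgExp ek η (fun b => toC (qsstarGIter (k + 1) v b)) fun b =>
        (∑ b', Hloc (fun j => if b' = j then (1 : ℝ) else 0) b * A b') - L⁻¹ ^ 2 * Dnext (S (Qes f)) b +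
          ∑ b', W1 (fun j => if b' = j then (1 : ℝ) else 0) b * (A - L⁻¹ ^ 2 • V) b') := by
    refine regular286_of_eqOn (fun l hl b hb => ?_) hU'
    simp only [bgExp]
    rw [linearMap_eq_kernelField Hloc A, linearMap_eq_kernelField W1 (A - L⁻¹ ^ 2 • V)]
  have hKf : (fun b => ∑ b', Hloc (fun j => if b' = j then (1 : ℝ) else 0) b * A b') = Hloc A :=
    (linearMap_eq_kernelField Hloc A).symm
  have hfin := regular286_uTilde561_of_kernels L h' hθ hLip hℓ hp hr hcA hcA' hK₁' hW₁' hA hK₀ hK₁ hK₂ hA' hW₀ hW₁ hW₂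
  rw [hKf] at hfin
  exact hfin

end

end Literature.MathematicalPhysics.QuantumFieldTheory.BalabanImbrieJaffe1984to88.BIJ88Regularity286EndToEnd
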